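import Mathlib
import HarnessLib

/-!
# Characters of `U(3)` restricted to the diagonal torus factor through `det`

Sibling of `UnitaryGroupTorusCharacters` (the indefinite `U(2,1)`): for the compact unitary group
`U(3) = Matrix.unitaryGroup (Fin 3) ℂ` and ANY homomorphism `χ : U(3) → A` to a commutative group,
`χ (diag(a,b,c)) = χ (diag(abc,1,1))` (`unitaryGroup_map_diagU3_eq`).  Proof: the permutation matrices of the
transpositions `0 ↔ 1`, `1 ↔ 2` are unitary and conjugate the torus coordinates, so `χ (diag(z,1,1)) =
χ (diag(1,z,1)) = χ (diag(1,1,z))` and `diag(a,b,c) = diag(a,1,1)·diag(1,b,1)·diag(1,1,c)`.  Kernel only; used by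
the Hodge-CM cell at the real places `b ≠ ι₁` where `G_U(L₀,b) = U(3)` (normalisation of the archimedean splitting,
D5-arch (b)). [folklore]
-/

set_option autoImplicit false

noncomputable section

open Matrix Complex ComplexConjugate

namespace Literature.Geometry.ComplexHyperbolic

namespace BallModel

/-- `conj z * z = 1` for `z ∈ Circle` (local copy; see `UnitaryGroupTorusCharacters`). [folklore] -/
theorem circle_conj_mul_self' (z : Circle) : conj (z : ℂ) * (z : ℂ) = 1 := by
  rw [← Circle.coe_inv_eq_conj, ← Circle.coe_mul, inv_mul_cancel, Circle.coe_one]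

/-- The diagonal matrix `diag(a, b, c)` (local copy of `diagMat`). [folklore] -/
def diagMat3 (a b c : ℂ) : Matrix (Fin 3) (Fin 3) ℂ := !![a, 0, 0; 0, b, 0; 0, 0, c]


/-- `U(3)` as Mathlib's unitary group of `3 × 3` complex matrices. [folklore] -/
abbrev U3 : Type := Matrix.unitaryGroup (Fin 3) ℂ

/-- A unit diagonal matrix is unitary. [folklore] -/
theorem diagMat_mem_unitaryGroup (a b c : Circle) : diagMat3 a b c ∈ Matrix.unitaryGroup (Fin 3) ℂ := by
  have ha : (a : ℂ) * conj (a : ℂ) = 1 := by rw [mul_comm]; exact circle_conj_mul_self' a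
  have hb : (b : ℂ) * conj (b : ℂ) = 1 := by rw [mul_comm]; exact circle_conj_mul_self' b
  have hc : (c : ℂ) * conj (c : ℂ) = 1 := by rw [mul_comm]; exact circle_conj_mul_self' c
  rw [Matrix.mem_unitaryGroup_iff]
  ext i j
  fin_cases i <;> fin_cases j <;>
    simp [diagMat3, Matrix.mul_apply, Fin.sum_univ_three, Matrix.star_apply] <;>
    first | exact ha | exact hb | exact hc

/-- The diagonal torus element `diag(a,b,c) ∈ U(3)`. [folklore] -/
def diagU3 (a b c : Circle) : U3 := ⟨diagMat3 a b c, diagMat_mem_unitaryGroup a b c⟩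

/-- Its matrix. [folklore] -/
@[simp] theorem coe_diagU3 (a b c : Circle) : ((diagU3 a b c : U3) : Matrix (Fin 3) (Fin 3) ℂ) = diagMat3 a b c :=
  rfl

/-- Multiplication on the torus of `U(3)`. [folklore] -/
theorem diagU3_mul (a b c a' b' c' : Circle) :
    diagU3 a b c * diagU3 a' b' c' = diagU3 (a * a') (b * b') (c * c') := by
  apply Subtype.ext
  change diagMat3 a b c * diagMat3 a' b' c' = diagMat3 (a * a') (b * b') (c * c')
  ext i j
  fin_cases i <;> fin_cases j <;> simp [diagMat3, Matrix.mul_apply, Fin.sum_univ_three]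

/-- `diag(1,1,1) = 1` in `U(3)`. [folklore] -/
@[simp] theorem diagU3_one : diagU3 1 1 1 = 1 := by
  apply Subtype.ext
  change diagMat3 1 1 1 = 1
  ext i j
  fin_cases i <;> fin_cases j <;> simp [diagMat3]

/-- The transposition matrix of coordinates `0, 1`. [folklore] -/
def swap01Mat : Matrix (Fin 3) (Fin 3) ℂ := !![0, 1, 0; 1, 0, 0; 0, 0, 1]

/-- The transposition matrix of coordinates `1, 2`. [folklore] -/
def swap12Mat : Matrix (Fin 3) (Fin 3) ℂ := !![1, 0, 0; 0, 0, 1; 0, 1, 0]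

/-- Permutation matrices are unitary (`0 ↔ 1`). [folklore] -/
theorem swap01Mat_mem : swap01Mat ∈ Matrix.unitaryGroup (Fin 3) ℂ := by
  rw [Matrix.mem_unitaryGroup_iff]
  ext i j
  fin_cases i <;> fin_cases j <;> simp [swap01Mat, Matrix.mul_apply, Fin.sum_univ_three, Matrix.star_apply]

/-- Permutation matrices are unitary (`1 ↔ 2`). [folklore] -/
theorem swap12Mat_mem : swap12Mat ∈ Matrix.unitaryGroup (Fin 3) ℂ := by
  rw [Matrix.mem_unitaryGroup_iff]
  ext i j
  fin_cases i <;> fin_cases j <;> simp [swap12Mat, Matrix.mul_apply, Fin.sum_univ_three, Matrix.star_apply]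

/-- The transposition `0 ↔ 1` in `U(3)`. [folklore] -/
def swap01 : U3 := ⟨swap01Mat, swap01Mat_mem⟩

/-- The transposition `1 ↔ 2` in `U(3)`. [folklore] -/
def swap12 : U3 := ⟨swap12Mat, swap12Mat_mem⟩

/-- `swap01 · diag(a,b,c) = diag(b,a,c) · swap01`. [folklore] -/
theorem swap01_mul_diagU3 (a b c : Circle) : swap01 * diagU3 a b c = diagU3 b a c * swap01 := by
  apply Subtype.ext
  change swap01Mat * diagMat3 a b c = diagMat3 b a c * swap01Mat
  ext i j
  fin_cases i <;> fin_cases j <;> simp [diagMat3, swap01Mat, Matrix.mul_apply, Fin.sum_univ_three]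

/-- `swap12 · diag(a,b,c) = diag(a,c,b) · swap12`. [folklore] -/
theorem swap12_mul_diagU3 (a b c : Circle) : swap12 * diagU3 a b c = diagU3 a c b * swap12 := by
  apply Subtype.ext
  change swap12Mat * diagMat3 a b c = diagMat3 a c b * swap12Mat
  ext i j
  fin_cases i <;> fin_cases j <;> simp [diagMat3, swap12Mat, Matrix.mul_apply, Fin.sum_univ_three]

section HomU3

variable {A : Type*} [CommGroup A] (χ : U3 →* A)

/-- Invariance under `0 ↔ 1`. [folklore] -/
theorem map_diagU3_swap01 (a b c : Circle) : χ (diagU3 a b c) = χ (diagU3 b a c) := by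
  have h := congrArg χ (swap01_mul_diagU3 a b c)
  rw [map_mul, map_mul, mul_comm (χ (diagU3 b a c))] at h
  exact mul_left_cancel h

/-- Invariance under `1 ↔ 2`. [folklore] -/
theorem map_diagU3_swap12 (a b c : Circle) : χ (diagU3 a b c) = χ (diagU3 a c b) := by
  have h := congrArg χ (swap12_mul_diagU3 a b c)
  rw [map_mul, map_mul, mul_comm (χ (diagU3 a c b))] at h
  exact mul_left_cancel h

/-- **`U(3)`**: for any homomorphism `χ : U(3) → A` to an abelian group, `χ (diag(a,b,c)) = χ (diag(abc,1,1))`.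
[folklore] -/
theorem unitaryGroup_map_diagU3_eq (a b c : Circle) : χ (diagU3 a b c) = χ (diagU3 (a * b * c) 1 1) := by
  have hsplit : diagU3 a b c = diagU3 a 1 1 * diagU3 1 b 1 * diagU3 1 1 c := by
    rw [diagU3_mul, diagU3_mul]
    simp
  have hb : χ (diagU3 1 b 1) = χ (diagU3 b 1 1) := map_diagU3_swap01 χ 1 b 1
  have hc : χ (diagU3 1 1 c) = χ (diagU3 c 1 1) := by
    rw [map_diagU3_swap12 χ 1 1 c, map_diagU3_swap01 χ 1 c 1]
  rw [hsplit, map_mul, map_mul, hb, hc, ← map_mul, ← map_mul, diagU3_mul, diagU3_mul]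
  simp

end HomU3

end BallModel

end Literature.Geometry.ComplexHyperbolic

end
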